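import Literature.Analysis.FluidPDE.Seregin2020SwirlSupBound
import Literature.Analysis.FluidPDE.SereginSverakMeridionalAxisDecay
import Literature.Analysis.FluidPDE.SereginSverakBlowupDecayProofs
import Literature.Analysis.FluidPDE.SereginSverakOffAxisScaling
import Literature.Analysis.FluidPDE.SereginSverakRescaledHypotheses
import Literature.Analysis.FluidPDE.SereginSverakSuitableProofs
import HarnessLib

/-!
# Seregin–Šverák 2009, Theorem 1.1 with the Type I rate on the meridional part only: the swirl
# bound of Lemma 3.3 supplied, and the theorem as printed (axially symmetric pair)

Analysis/FluidPDE proofs file (theorems only: no definitions, no named facts) on the discharge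
path of the named fact `Literature.Analysis.FluidPDE.SereginSverak2009.MeridionalTypeIRegularity`
(G. Seregin, V. Šverák, *On Type I singularities of the local axi-symmetric solutions of the
Navier–Stokes equations*, Comm. PDE 34 (2009) = arXiv:0804.1803, Thm 1.1 (p. 3) with hypothesis
(1.1) (p. 2): the rate `|v̄| ≤ C/√(-t)` on the meridional part `v̄ = v_ϱ e_ϱ + v₃ e₃` only).

The tree proves Theorem 1.1 GIVEN the swirl bound (as7) `|ϱ v_φ| ≤ C₂` on `Q(1/2)`
(`SereginSverak2009.isRegularAtOrigin_of_meridionalTypeI_of_swirlBound_half`,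
`SereginSverakMeridionalAxisDecay.lean`), i.e. modulo Lemma 3.3 of the paper (arXiv p. 9, proof in
App. II by a Moser iteration): "(as1) `sup_{z ∈ Q(1/2)} |ϱ v_φ(z)| ≤ C(M) (∫_{Q(3/4)} |ϱ v_φ|^{10/3} dz)^{3/10}`".
That Moser iteration is in the tree in the form of G. Seregin, Anal. Math. Phys. 10 (2020) Paper 46 =
arXiv:2006.04140, proof of Thm 2.1, (2.6) (which removes the hypothesis (r2) of Lemma 3.3):
`Seregin2020.swirl_ae_bounded_half` (`Seregin2020SwirlSupBound.lean`) — for an axially symmetric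
suitable weak solution `(v, q)` in the unit cylinder `Q` with `v ∈ L_{2,∞}(Q)`, `∇v ∈ L₂(Q)`,
`q ∈ L_{3/2}(Q)`, the swirl is essentially bounded on `]-1/4, 0[ × B(0, 1/2)`. This file feeds it
into the Seregin–Šverák assembly:

* `isRegularAtOrigin_of_meridionalTypeI_of_swirlBound_cyl` — Thm 1.1 given the swirl bound on
  ANY `Q(r)`, `0 < r ≤ 1` (the zoom `ũ(s, y) = r u(r² s, r y)`; "The general case is obtained by
  re-scaling", §3 p. 9), extending the tree's `…_half` (`r = 1/2`);
* `exists_swirlBound_parCyl_of_axisymmetricPressure` — **Lemma 3.3 in the class of Theorem 1.1**: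
  under the standing assumptions of §3 with axial symmetry of the PAIR `(v, q)` and (r2), the swirl
  `ϱ v_φ` is essentially bounded on `Q(1/16)` (Remark 3.4: `(v, q)` is suitable in `Q`
  (`SuitableOfBounded_holds`); the local energy bound (as12)/(as6) at the origin
  (`localEnergy36`) puts the zoom `v ↦ ¼ v(s/16, y/4)` in the class of `swirl_ae_bounded_half` on
  the whole unit cylinder; the bound on `]-1/4, 0[ × B(0, 1/2)` contains `Q(1/4)` of the zoom, i.e.
  `Q(1/16)` of `v`);
* `isRegularAtOrigin_of_meridionalTypeI` — **Theorem 1.1 / 3.1 with (1.1), AS PRINTED**: "Assume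
  that functions `v ∈ L₃(Q)` and `q ∈ L_{3/2}(Q)` are an axially symmetric weak solution to the
  Navier–Stokes equations in `Q`" (`IsAxisymmetricLocalSolution` + axial symmetry of the pressure
  slices, `q_{,φ} = 0`), (r2), and (1.1) on `v̄`; then `z = 0` is a regular point of `v`.

The named fact `MeridionalTypeIRegularity` omits the axial symmetry of the pressure (its class
`IsAxisymmetricLocalSolution` constrains the velocity slices only); it follows from
`isRegularAtOrigin_of_meridionalTypeI` once the pressure is replaced by its rotation average, which
is not done in this file. Nothing here asserts that a singular axisymmetric solution exists:
these are a-priori statements about hypothetical ones (WHAT THIS IS NOT: not a claim about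
Navier–Stokes blow-up or regularity).

## References

* G. Seregin, V. Šverák, Comm. PDE 34 (2009) 171–201 = arXiv:0804.1803: Thm 1.1 (p. 3), (1.1)
  (p. 2), §3 Thm 3.1, Lemma 3.3 (as1), Remark 3.4, Lemma 3.5 (as6)–(as7) (p. 9), §4 (p. 11).
  [SereginSverak2009]
* G. Seregin, Anal. Math. Phys. 10 (2020), Paper 46 = arXiv:2006.04140, proof of Thm 2.1, (2.6)
  (arXiv pp. 5–7). [Seregin2020]
-/

noncomputable section

open MeasureTheory Set Function Filter Topology TopologicalSpace Metric
open scoped NNReal ENNReal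

namespace Literature.Analysis.FluidPDE

namespace SereginSverak2009

/-! ### Theorem 1.1 given the swirl bound on a cylinder `Q(r)` of any size -/

/-- **Seregin–Šverák 2009, Thm 1.1 (rate on `v̄`) given the swirl bound on `Q(r)`, `0 < r ≤ 1`**:
under the standing assumptions of §3 with axial symmetry, (r2), (1.1) and `|ϱ v_φ| ≤ C₂` a.e. on
`Q(r) = 𝒞(r) × ]-r², 0[`, the origin is a regular point. Reduced to the tree's
`isRegularAtOrigin_of_meridionalTypeI_of_swirlBound` (swirl bound on all of `Q`) by the zoom
`ũ(s, y) = r u(r² s, r y)` (`Q = Φ⁻¹(Q(r))`), which preserves the standing assumptions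
(`isAxisymmetricLocalSolution_rescale`), (r2) (`isBoundedAwayFromZero_rescale`) and (1.1)
(`ae_meridionalRate_shiftZoom`), carries the swirl bound from `Q(r)` to `Q` (`swirl_axis_zoom_self`),
and lets regularity of the origin pull back (`isRegularAtOrigin_of_rescale`) — verbatim the tree's
`…_half` with `r` for `1/2` ("The general case is obtained by re-scaling", §3 p. 9).
[cite: SereginSverak2009, Thm 1.1 (arXiv p. 3) with (1.1) (p. 2), Lemma 3.3 (as1)/(as7) and §3 p. 9 (re-scaling)] -/
theorem isRegularAtOrigin_of_meridionalTypeI_of_swirlBound_cyl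
    {u : ℝ → EuclideanSpace ℝ (Fin 3) → EuclideanSpace ℝ (Fin 3)}
    {p : ℝ → EuclideanSpace ℝ (Fin 3) → ℝ}
    (hsol : IsAxisymmetricLocalSolution u p) (hr2 : IsBoundedAwayFromZero u)
    (hmer : IsMeridionalTypeIOnCyl u) {r : ℝ} (hr : 0 < r) (hr1 : r ≤ 1)
    (hsw : ∃ C₂ : ℝ, ∀ᵐ z ∂(volume.restrict (parCyl 0 r)), |swirl (u z.1) z.2| ≤ C₂) :
    IsRegularAtOrigin u := by
  obtain ⟨C, hC⟩ := hmer
  obtain ⟨C₂, hC₂⟩ := hsw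
  have ht₀ : (0 : ℝ) ≤ 0 := le_rfl
  have ht₁ : (-1 : ℝ) ≤ 0 - r ^ 2 := by nlinarith
  set v := r • stPull (r ^ 2) r 0 ((0 : ℝ) • eZ) u with hv
  set q := (r ^ 2) • stPull (r ^ 2) r 0 ((0 : ℝ) • eZ) p with hq
  have hsol' : IsAxisymmetricLocalSolution v q :=
    isAxisymmetricLocalSolution_rescale hsol hr hr1 ht₀ ht₁
  have hr2' : IsBoundedAwayFromZero v := isBoundedAwayFromZero_rescale hr2 hr hr1 ht₀ ht₁
  have hmer' : IsMeridionalTypeIOnCyl v := ⟨C, ae_meridionalRate_shiftZoom hC hr hr1 ht₀ ht₁⟩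
  -- the swirl bound on `Q(r)` pulls back to `Q = Φ⁻¹(Q(r))`
  have hpre : stAffine (r ^ 2) r 0 ((0 : ℝ) • eZ) ⁻¹' parCyl 0 r = parCyl 0 1 := by
    have h := stAffine_preimage_parCyl hr 0 ((0 : ℝ) • eZ) r
    rw [prod_zero_zero_smul_eZ] at h
    rw [h, div_self hr.ne']
  have hsw' : ∀ᵐ z ∂(volume.restrict (parCyl 0 1)), |swirl (v z.1) z.2| ≤ C₂ := by
    have h1 := ae_restrict_preimage_stAffine (sq_pos_of_pos hr) hr 0 ((0 : ℝ) • eZ) hC₂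
    rw [hpre] at h1
    filter_upwards [h1] with z hz
    rw [stAffine_fst, stAffine_snd] at hz
    have hfun : v z.1 = fun y => r • u (0 + r ^ 2 * z.1) ((0 : ℝ) • eZ + r • y) := rfl
    rw [hfun, swirl_axis_zoom_self cylRadius_zero_smul_eZ r (u (0 + r ^ 2 * z.1)) z.2]
    exact hz
  exact isRegularAtOrigin_of_rescale hr
    (isRegularAtOrigin_of_meridionalTypeI_of_swirlBound hsol' hr2' hmer' ⟨C₂, hsw'⟩)

/-! ### Lemma 3.3 in the class of Theorem 1.1: the swirl bound from Seregin 2020, (2.6) -/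

/-- Scalar axial symmetry is preserved by the axis-centred zoom `y ↦ c y` and scalar multiples
(the pressure `λ² q(λ² s, λ y)` of the rescaled pair is again axially symmetric).
[cite: SereginSverak2009, §3 p. 9 ("new functions u and p satisfy the Navier–Stokes equations"), axial symmetry of the pair] -/
theorem isAxisymmetricScalar_smul_comp_smul {f : EuclideanSpace ℝ (Fin 3) → ℝ}
    (hf : IsAxisymmetricScalar f) (a c : ℝ) :
    IsAxisymmetricScalar fun y => a * f (((0 : ℝ) • eZ : EuclideanSpace ℝ (Fin 3)) + c • y) := by
  intro θ y
  simp only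
  rw [zero_smul, zero_add, zero_add, ← rotZ_smul_vec, hf θ]

/-- `Q(r) ⊆ ]-R², 0[ × B(0, R)` when `0 < r`, `2 r² ≤ R²` (`‖x‖² = |x'|² + x₃² < 2r²`): the
cylinder `Q(1/4)` of Seregin–Šverák lies in the parabolic cylinder `Q_{1/2}(0)` on which
Seregin 2020's (2.6) is stated. [cite: SereginSverak2009, §3 p. 9 ("we replace the usual balls with cylinders")] -/
theorem parCyl_subset_parabolicCylinder {r R : ℝ} (hr : 0 < r) (hR : 0 < R) (hrR : 2 * r ^ 2 ≤ R ^ 2) :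
    parCyl (0 : ℝ × EuclideanSpace ℝ (Fin 3)) r ⊆
      parabolicCylinder R (0 : ℝ × EuclideanSpace ℝ (Fin 3)) := by
  intro z hz
  rw [mem_parCyl_zero] at hz
  obtain ⟨⟨h1, h2⟩, h3, h4⟩ := hz
  rw [mem_parabolicCylinder]
  simp only [Prod.fst_zero, Prod.snd_zero, dist_zero_right, zero_sub]
  have hρ := cylRadius_nonneg z.2
  have h3' : cylRadius z.2 ^ 2 < r ^ 2 := by nlinarith
  have h4' : z.2 2 ^ 2 < r ^ 2 := by
    have := abs_nonneg (z.2 2)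
    calc z.2 2 ^ 2 = |z.2 2| ^ 2 := (sq_abs _).symm
      _ < r ^ 2 := by nlinarith
  have hn : ‖z.2‖ ^ 2 < R ^ 2 := by
    rw [norm_sq_eq_cylRadius_sq_add]
    linarith
  refine ⟨⟨by nlinarith, h2⟩, ?_⟩
  exact lt_of_pow_lt_pow_left₀ 2 hR.le hn

/-- **Seregin–Šverák 2009, Lemma 3.3 in the class of Theorem 1.1 (swirl bound near the origin),
from Seregin 2020's (2.6).** Under the standing assumptions of §3 (`IsAxisymmetricLocalSolution`:
distributional Navier–Stokes in `Q`, `v ∈ L₃(Q)`, `q ∈ L_{3/2}(Q)`, axially symmetric velocity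
slices), axial symmetry of the pressure slices and (r2), there is `C₂` with `|ϱ v_φ| ≤ C₂` a.e.
on `Q(1/16)`. PROOF: by Remark 3.4 (`SuitableOfBounded_holds`) `(v, q)` is a suitable weak solution
in `Q`, with weak gradient `G`; by the local energy inequality at the origin (`localEnergy36` at
`z_b = 0`, `r = 1/2`: (as12)/(as6)) `A(0, 1/4; v) + E(0, 1/4; G) < ∞`; hence the axis-centred zoom
`(¼ v(s/16, y/4), (1/16) q(s/16, y/4))` is suitable in `Q` (Remark 3.4 again, the class being
scale invariant: `isAxisymmetricLocalSolution_rescale`, `isBoundedAwayFromZero_rescale`), lies in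
`L_{2,∞}(Q)` with gradient `(1/16) G(s/16, y/4) ∈ L₂(Q)` (`energyA_rescale_le`,
`dissipationE_rescale`, `HasWeakSpatialGradientOn.stRescale`) and has axially symmetric velocity
and pressure slices; Seregin 2020 (2.6) (`Seregin2020.swirl_ae_bounded_half`) bounds its swirl
a.e. on `]-1/4, 0[ × B(0, 1/2) ⊇ Q(1/4)`, and `Q(1/4)` of the zoom is `Q(1/16)` of `v`
(`swirl_axis_zoom_self`: `Γ_{λv∘Φ}(s, y) = Γ_v(λ² s, λ y)`).
[cite: SereginSverak2009, Lemma 3.3 (as1) with Remark 3.4 and (as6)–(as7) (arXiv p. 9); Seregin2020, proof of Thm 2.1, (2.6) (arXiv pp. 5–7)] -/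
theorem exists_swirlBound_parCyl_of_axisymmetricPressure
    {u : ℝ → EuclideanSpace ℝ (Fin 3) → EuclideanSpace ℝ (Fin 3)}
    {p : ℝ → EuclideanSpace ℝ (Fin 3) → ℝ}
    (hsol : IsAxisymmetricLocalSolution u p) (hr2 : IsBoundedAwayFromZero u)
    (hp_ax : ∀ t ∈ Ioo (-1 : ℝ) 0, IsAxisymmetricScalar (p t)) :
    ∃ C₂ : ℝ, ∀ᵐ z ∂(volume.restrict (parCyl 0 (1 / 16))), |swirl (u z.1) z.2| ≤ C₂ := by
  -- Remark 3.4: `(u, p)` is suitable in `Q`; its weak gradient `G`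
  have hsw : IsSuitableWeakSolutionOn (parCylOpens 0 1) 1 0 u p := SuitableOfBounded_holds u p hsol hr2
  obtain ⟨G, hG, -, -⟩ := hsw.localEnergy
  -- (as12)/(as6) at the origin: `E(0, 1/4; G) + A(0, 1/4; u) < ∞`
  obtain ⟨c36, hc36⟩ := localEnergy36
  have hb : |(0 : ℝ)| ≤ 1 / 4 := by norm_num
  have key := hc36 u p hsol hr2 G hG 0 hb (1 / 2) (by norm_num) (by norm_num)
  have hC3 : cubicC ((0 : ℝ), (0 : ℝ) • eZ) (1 / 2) u < ⊤ := by
    rw [prod_zero_zero_smul_eZ]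
    unfold cubicC
    refine ENNReal.mul_lt_top (ENNReal.inv_lt_top.2 (by positivity)) ?_
    exact lt_of_le_of_lt (lintegral_mono_set (parCyl_mono 0 (by norm_num) (by norm_num)))
      hsol.velocity_L3
  have hD : pressureD ((0 : ℝ), (0 : ℝ) • eZ) (1 / 2) p < ⊤ := by
    rw [prod_zero_zero_smul_eZ]
    unfold pressureD
    refine ENNReal.mul_lt_top (ENNReal.inv_lt_top.2 (by positivity)) ?_
    exact lt_of_le_of_lt (lintegral_mono_set (parCyl_mono 0 (by norm_num) (by norm_num)))
      hsol.pressure_L32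
  have hRHS : (c36 : ℝ≥0∞) * (cubicC ((0 : ℝ), (0 : ℝ) • eZ) (1 / 2) u ^ (2 / 3 : ℝ) +
      cubicC ((0 : ℝ), (0 : ℝ) • eZ) (1 / 2) u + pressureD ((0 : ℝ), (0 : ℝ) • eZ) (1 / 2) p) < ⊤ := by
    refine ENNReal.mul_lt_top ENNReal.coe_lt_top ?_
    refine ENNReal.add_lt_top.2 ⟨ENNReal.add_lt_top.2 ⟨?_, hC3⟩, hD⟩
    exact ENNReal.rpow_lt_top_of_nonneg (by norm_num) hC3.ne
  have hE : dissipationE ((0 : ℝ), (0 : ℝ) • eZ) (1 / 4) G < ⊤ := by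
    have h := lt_of_le_of_lt (le_trans le_self_add key) hRHS
    norm_num at h ⊢
    exact h
  have hA : energyA ((0 : ℝ), (0 : ℝ) • eZ) (1 / 4) u < ⊤ := by
    have h := lt_of_le_of_lt (le_trans le_add_self key) hRHS
    norm_num at h ⊢
    exact h
  -- the zoom by `λ = 1/4`
  have hc : (0 : ℝ) < 1 / 4 := by norm_num
  have hc1 : (1 / 4 : ℝ) ≤ 1 := by norm_num
  have ht₀ : (0 : ℝ) ≤ 0 := le_rfl
  have ht₁ : (-1 : ℝ) ≤ 0 - (1 / 4 : ℝ) ^ 2 := by norm_num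
  set v := (1 / 4 : ℝ) • stPull ((1 / 4 : ℝ) ^ 2) (1 / 4 : ℝ) 0 ((0 : ℝ) • eZ) u with hv
  set q := ((1 / 4 : ℝ) ^ 2) • stPull ((1 / 4 : ℝ) ^ 2) (1 / 4 : ℝ) 0 ((0 : ℝ) • eZ) p with hq
  set Gv := ((1 / 4 : ℝ) * (1 / 4 : ℝ)) • stPull ((1 / 4 : ℝ) ^ 2) (1 / 4 : ℝ) 0 ((0 : ℝ) • eZ) G
    with hGv
  have hsol' : IsAxisymmetricLocalSolution v q :=
    isAxisymmetricLocalSolution_rescale hsol hc hc1 ht₀ ht₁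
  have hr2' : IsBoundedAwayFromZero v := isBoundedAwayFromZero_rescale hr2 hc hc1 ht₀ ht₁
  have hsw' : IsSuitableWeakSolutionOn (parCylOpens 0 1) 1 0 v q := SuitableOfBounded_holds v q hsol' hr2'
  -- the rescaled weak gradient on `Q ⊆ Φ⁻¹(Q)`
  have hGv' : HasWeakSpatialGradientOn (parCylOpens 0 1) v Gv := by
    have h1 := hG.stRescale (1 / 4 : ℝ) (sq_pos_of_pos hc) hc 0 ((0 : ℝ) • eZ)
    refine h1.mono ?_
    intro z hz
    rw [← SetLike.mem_coe, coe_stPreimage, coe_parCylOpens]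
    exact parCyl_one_subset_preimage hc hc1 ht₀ ht₁ hz
  -- `∇v ∈ L₂(Q)`: `E(0, 1; Gv) = E(0, 1/4; G)`
  have hEv : ∫⁻ z in parCyl 0 1, ENNReal.ofReal (frobeniusNormSq (Gv z.1 z.2)) < ∞ := by
    have h1 : dissipationE 0 1 Gv = dissipationE ((0 : ℝ), (0 : ℝ) • eZ) (1 / 4 * 1) G :=
      dissipationE_rescale hc 0 one_pos G
    rw [mul_one] at h1
    have h2 : dissipationE (0 : ℝ × EuclideanSpace ℝ (Fin 3)) 1 Gv < ⊤ := h1 ▸ hE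
    unfold dissipationE at h2
    simpa using h2
  -- `v ∈ L_{2,∞}(Q)`: `A(0, 1; v) ≤ A(0, 1/4; u)`
  have hAv : ∃ C : ℝ≥0, ∀ᵐ t ∂(volume.restrict (Ioo (-1 : ℝ) 0)),
      ∫⁻ x in spaceCyl 0 1, ‖v t x‖ₑ ^ 2 ≤ C := by
    have h1 : energyA 0 1 v ≤ energyA ((0 : ℝ), (0 : ℝ) • eZ) (1 / 4 * 1) u :=
      energyA_rescale_le hc 0 one_pos u
    rw [mul_one] at h1
    have h2 : energyA (0 : ℝ × EuclideanSpace ℝ (Fin 3)) 1 v < ⊤ := lt_of_le_of_lt h1 hA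
    refine ⟨(energyA (0 : ℝ × EuclideanSpace ℝ (Fin 3)) 1 v).toNNReal, ?_⟩
    rw [ENNReal.coe_toNNReal h2.ne]
    have h3 := ENNReal.ae_le_essSup (μ := volume.restrict (Ioo ((0 : ℝ × EuclideanSpace ℝ (Fin 3)).1 - 1 ^ 2)
      (0 : ℝ × EuclideanSpace ℝ (Fin 3)).1))
      (fun t : ℝ => (ENNReal.ofReal (1 : ℝ))⁻¹ *
        ∫⁻ x in spaceCyl (0 : ℝ × EuclideanSpace ℝ (Fin 3)).2 1, ‖v t x‖ₑ ^ 2)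
    have e1 : Ioo ((0 : ℝ × EuclideanSpace ℝ (Fin 3)).1 - 1 ^ 2) (0 : ℝ × EuclideanSpace ℝ (Fin 3)).1 =
        Ioo (-1 : ℝ) 0 := by simp
    rw [e1] at h3
    filter_upwards [h3] with t ht
    have e2 : (ENNReal.ofReal (1 : ℝ))⁻¹ = 1 := by simp
    rw [e2, one_mul] at ht
    simpa [energyA] using ht
  -- axial symmetry of the zoomed pressure slices
  have hq_ax : ∀ t ∈ Ioo (-1 : ℝ) 0, IsAxisymmetricScalar (q t) := by
    intro t ht
    have ht' : 0 + (1 / 4 : ℝ) ^ 2 * t ∈ Ioo (-1 : ℝ) 0 := by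
      constructor <;> nlinarith [ht.1, ht.2]
    have hfun : q t = fun y => (1 / 4 : ℝ) ^ 2 * p (0 + (1 / 4 : ℝ) ^ 2 * t)
        (((0 : ℝ) • eZ : EuclideanSpace ℝ (Fin 3)) + (1 / 4 : ℝ) • y) := by
      funext y; rfl
    rw [hfun]
    exact isAxisymmetricScalar_smul_comp_smul (hp_ax _ ht') _ _
  -- Seregin 2020, (2.6), for the zoom
  obtain ⟨K, hK⟩ := Seregin2020.swirl_ae_bounded_half v q Gv hsw' hAv hGv' hEv hsol'.pressure_L32
    hsol'.axisymmetric hq_ax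
  -- restrict to `Q(1/4) ⊆ ]-1/4, 0[ × B(0, 1/2)` and pull back to `Q(1/16)` of `u`
  have hK' : ∀ᵐ z ∂(volume.restrict (parCyl 0 (1 / 4))), |swirl (v z.1) z.2| ≤ K :=
    ae_restrict_of_ae_restrict_of_subset
      (parCyl_subset_parabolicCylinder (by norm_num) (by norm_num) (by norm_num)) hK
  have hpre : parCyl (0 : ℝ × EuclideanSpace ℝ (Fin 3)) (1 / 4) =
      stAffine ((1 / 4 : ℝ) ^ 2) (1 / 4 : ℝ) 0 ((0 : ℝ) • eZ) ⁻¹' parCyl ((0 : ℝ), (0 : ℝ) • eZ) (1 / 16) := by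
    rw [stAffine_preimage_parCyl hc]
    norm_num
  refine ⟨K, ?_⟩
  have hK'' : ∀ᵐ z ∂(volume.restrict (stAffine ((1 / 4 : ℝ) ^ 2) (1 / 4 : ℝ) 0 ((0 : ℝ) • eZ) ⁻¹'
      parCyl ((0 : ℝ), (0 : ℝ) • eZ) (1 / 16))),
      |swirl (u (stAffine ((1 / 4 : ℝ) ^ 2) (1 / 4 : ℝ) 0 ((0 : ℝ) • eZ) z).1)
        (stAffine ((1 / 4 : ℝ) ^ 2) (1 / 4 : ℝ) 0 ((0 : ℝ) • eZ) z).2| ≤ K := by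
    rw [← hpre]
    filter_upwards [hK'] with z hz
    rw [stAffine_fst, stAffine_snd]
    have hfun : v z.1 = fun y => (1 / 4 : ℝ) • u (0 + (1 / 4 : ℝ) ^ 2 * z.1) ((0 : ℝ) • eZ + (1 / 4 : ℝ) • y) := rfl
    rw [hfun, swirl_axis_zoom_self cylRadius_zero_smul_eZ (1 / 4 : ℝ) (u (0 + (1 / 4 : ℝ) ^ 2 * z.1)) z.2] at hz
    exact hz
  have hback := ae_restrict_of_ae_restrict_preimage_stAffine (sq_pos_of_pos hc) hc 0 ((0 : ℝ) • eZ)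
    (P := fun w => |swirl (u w.1) w.2| ≤ K) hK''
  rw [prod_zero_zero_smul_eZ] at hback
  exact hback

/-! ### Theorem 1.1 with (1.1), as printed -/

/-- **Seregin–Šverák 2009, Theorem 1.1 (= Thm 3.1 on the canonical domain) with the Type I rate
on the meridional part only, as printed.** "Assume that functions `v ∈ L₃(Q)` and `q ∈ L_{3/2}(Q)`
are an axially symmetric weak solution to the Navier–Stokes equations in `Q`" — the standing
assumptions of §3 with axial symmetry of velocity AND pressure slices —, "Let, in addition," (r2)
`v ∈ L_∞(𝒞 × ]-1, -a²[)` for each `0 < a < 1` (Lemma 3.3 / Thm 3.2; implied by the setting of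
Thm 1.1, where `z₀` is the first singular time under consideration) and (1.1)
`|v̄(x, t)| ≤ C/√(-t)` a.e. in `Q` for the meridional part `v̄ = v_ϱ e_ϱ + v₃ e₃`. "Then `z = 0`
is a regular point of `v`." PROOF: Lemma 3.3 (`exists_swirlBound_parCyl_of_axisymmetricPressure`:
`|ϱ v_φ| ≤ C₂` a.e. on `Q(1/16)`) and the assembly of §§3–4 given the swirl bound
(`isRegularAtOrigin_of_meridionalTypeI_of_swirlBound_cyl` at `r = 1/16`: Lemma 3.5, Prop 3.7,
the blow-up procedure and KNSS 2009 Thm 5.3). [cite: SereginSverak2009, Thm 1.1 (arXiv p. 3) with (1.1) (p. 2); §3 Thm 3.1, Lemma 3.3, Remark 3.4, Lemma 3.5, Prop 3.7 (pp. 9–10); §4 (p. 11)] -/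
theorem isRegularAtOrigin_of_meridionalTypeI
    {u : ℝ → EuclideanSpace ℝ (Fin 3) → EuclideanSpace ℝ (Fin 3)}
    {p : ℝ → EuclideanSpace ℝ (Fin 3) → ℝ}
    (hsol : IsAxisymmetricLocalSolution u p) (hr2 : IsBoundedAwayFromZero u)
    (hmer : IsMeridionalTypeIOnCyl u) (hp_ax : ∀ t ∈ Ioo (-1 : ℝ) 0, IsAxisymmetricScalar (p t)) :
    IsRegularAtOrigin u :=
  isRegularAtOrigin_of_meridionalTypeI_of_swirlBound_cyl hsol hr2 hmer (r := 1 / 16) (by norm_num)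
    (by norm_num) (exists_swirlBound_parCyl_of_axisymmetricPressure hsol hr2 hp_ax)

end SereginSverak2009

end Literature.Analysis.FluidPDE

end
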